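import Mathlib.RingTheory.Ideal.Height
import Mathlib.RingTheory.Ideal.KrullsHeightTheorem
import Mathlib.RingTheory.Ideal.MinimalPrime.Localization
import Mathlib.RingTheory.Ideal.MinimalPrime.Noetherian
import HarnessLib

/-!
# Parameters adapted to a prime (crux `FrobeniusLadder.FRationalResolution`, line `Sketch`)

Stub `exists_span_le_prime_minimalPrimes_height` of the skeleton `Sketch` for crux
stmt-ResolutionOfSingularities-15317 (theme LOC: F-rationality localizes). The converse of Krull's
height theorem WITH HEIGHT CONTROL: in a Noetherian ring `R`, a prime `P` of height `h` contains
`h` elements `x₁, …, x_h` such that `P` is a minimal prime of `(x₁, …, x_h)` and EVERY minimal prime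
of `(x₁, …, x_h)` has height exactly `h`.

Proof: greedy prime avoidance. By induction on `i ≤ h` we build `x₁, …, xᵢ ∈ P` all of whose
minimal primes have height exactly `i` (`i = 0`: the minimal primes of `R` have height `0`). For the
step, the finitely many minimal primes `Q₁, …, Q_r` of `(x₁, …, xᵢ)` have height `i < h = ht P`, so
none contains `P`, and prime avoidance gives `x_{i+1} ∈ P` outside all of them; a minimal prime `Q'`
of `(x₁, …, x_{i+1})` contains some `Q_j` strictly (it contains `x_{i+1}`), so `ht Q' ≥ i + 1`, and
`ht Q' ≤ i + 1` by Krull's height theorem. At `i = h`, `ht P = h = ht (x₁, …, x_h)` forces `P` to be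
a minimal prime of `(x₁, …, x_h)`.
-/

set_option linter.dupNamespace false

noncomputable section

namespace Summit.ResolutionOfSingularities.ResolutionOfSingularities.Theorems.FRationalResolution

open IsLocalRing

/-- Krull's height theorem for a family indexed by `Fin n`: a minimal prime of the ideal spanned
by `n` elements has height at most `n`. -/
theorem height_le_of_mem_minimalPrimes_span_range {R : Type*} [CommRing R] [IsNoetherianRing R]
    {n : ℕ} (x : Fin n → R) {Q : Ideal R} (hQ : Q ∈ (Ideal.span (Set.range x)).minimalPrimes) :
    Q.height ≤ n := by
  classical
  have hset : ((Finset.univ.image x : Finset R) : Set R) = Set.range x := by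
    rw [Finset.coe_image, Finset.coe_univ, Set.image_univ]
  rw [← hset] at hQ
  refine (Ideal.height_le_card_of_mem_minimalPrimes_span_finset hQ).trans ?_
  exact_mod_cast Finset.card_image_le.trans (by rw [Finset.card_univ, Fintype.card_fin])

/-- The inductive construction: for every `i ≤ ht P` there are `x₁, …, xᵢ ∈ P` such that every
minimal prime of `(x₁, …, xᵢ)` has height exactly `i`. -/
theorem exists_forall_mem_minimalPrimes_height_eq {R : Type*} [CommRing R] [IsNoetherianRing R]
    (P : Ideal R) [P.IsPrime] {h : ℕ} (hh : P.height = h) :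
    ∀ i ≤ h, ∃ x : Fin i → R, (∀ j, x j ∈ P) ∧
      ∀ Q ∈ (Ideal.span (Set.range x)).minimalPrimes, Q.height = i := by
  intro i
  induction i with
  | zero =>
    intro _
    refine ⟨Fin.elim0, fun j => j.elim0, fun Q hQ => ?_⟩
    rw [Set.range_eq_empty, Ideal.span_empty] at hQ
    have : Q.IsPrime := hQ.1.1
    rw [Nat.cast_zero, Ideal.height_eq_zero_iff]
    exact hQ
  | succ i ih =>
    intro hi
    obtain ⟨x, hxP, hx⟩ := ih (Nat.le_of_succ_le hi)
    set J : Ideal R := Ideal.span (Set.range x) with hJ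
    have hSfin : J.minimalPrimes.Finite := J.finite_minimalPrimes_of_isNoetherianRing
    -- prime avoidance: `P ⊄ ⋃ J.minimalPrimes` since these have height `i < h = ht P`
    have havoid : ¬ ((P : Set R) ⊆ ⋃ K ∈ J.minimalPrimes, (K : Set R)) := by
      rw [Ideal.subset_union_prime_finite hSfin P P (fun K hK _ _ => hK.1.1)]
      rintro ⟨K, hK, hle⟩
      have h1 := Ideal.height_mono hle
      rw [hh, hx K hK] at h1
      have h2 : (i : ℕ∞) < h := by exact_mod_cast hi
      exact lt_irrefl _ (h2.trans_le h1)
    obtain ⟨y, hyP, hy⟩ := Set.not_subset.mp havoid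
    have hy' : ∀ K ∈ J.minimalPrimes, y ∉ K := fun K hK hyK => hy (Set.mem_biUnion hK hyK)
    refine ⟨Fin.snoc x y, fun j => ?_, fun Q hQ => ?_⟩
    · refine Fin.lastCases ?_ (fun j => ?_) j
      · rw [Fin.snoc_last]
        exact hyP
      · rw [Fin.snoc_castSucc]
        exact hxP j
    · have hQp : Q.IsPrime := hQ.1.1
      refine le_antisymm (height_le_of_mem_minimalPrimes_span_range _ hQ) ?_
      rw [Fin.range_snoc, Ideal.span_insert] at hQ
      have hJQ : J ≤ Q := le_sup_right.trans hQ.1.2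
      have hyQ : y ∈ Q := hQ.1.2 (Ideal.mem_sup_left (Ideal.mem_span_singleton_self y))
      obtain ⟨K, hK, hKQ⟩ := Ideal.exists_minimalPrimes_le hJQ
      have hKp : K.IsPrime := hK.1.1
      have hlt : K < Q := lt_of_le_of_ne hKQ fun e => hy' K hK (e ▸ hyQ)
      have h3 := Ideal.height_strict_mono_of_isPrime hlt
      rw [hx K hK] at h3
      rw [Nat.cast_succ]
      exact Order.add_one_le_of_lt h3

/-- LOC1: height-many elements of a prime generating an ideal with that prime minimal and all
minimal primes of the same height -/
theorem exists_span_le_prime_minimalPrimes_height (R : Type) [CommRing R] [IsNoetherianRing R]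
    (P : Ideal R) [P.IsPrime] {h : ℕ} (hh : P.height = h) :
    ∃ x : Fin h → R, (∀ i, x i ∈ P) ∧ P ∈ (Ideal.span (Set.range x)).minimalPrimes ∧
      ∀ Q ∈ (Ideal.span (Set.range x)).minimalPrimes, Q.height = h := by
  obtain ⟨x, hxP, hx⟩ := exists_forall_mem_minimalPrimes_height_eq P hh h le_rfl
  refine ⟨x, hxP, ?_, hx⟩
  have hle : Ideal.span (Set.range x) ≤ P := Ideal.span_le.mpr (Set.range_subset_iff.mpr hxP)
  refine Ideal.mem_minimalPrimes_of_height_eq hle ?_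
  rw [hh, (Ideal.span (Set.range x)).height_eq_inf_minimalPrimes]
  exact le_iInf₂ fun Q hQ => (hx Q hQ).ge

end Summit.ResolutionOfSingularities.ResolutionOfSingularities.Theorems.FRationalResolution

end
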